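import Literature.Computability.Complexity.GF2KernelProgram
import HarnessLib

/-!
# Solvability of an inhomogeneous linear system over `GF(2)` as a functional program, in polynomial
# time on codes

Companion of `GF2KernelProgram.lean` (which decides the existence of a nonzero KERNEL vector). Here
the decision is SOLVABILITY of `A x = b` over `GF(2)`, for a system given by its augmented rows
`r = (a_r ++ [b_r])` (coefficients first, right-hand side LAST): `x` solves the system iff every
augmented row is orthogonal to `x ++ [1]` (`GF2Kernel.dotB`). Gaussian elimination on the coefficient
columns, reusing the column step of the kernel program (`GF2Kernel.elimRow`, `GF2Kernel.pivot`):

* `solv n rows` — `n` coefficient columns: eliminate the first column with the first row having a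
  leading `1` (or just drop it if there is none), `n` times; then the system is solvable iff every
  remaining right-hand side is `0`; `Solvable n rows` — the specification; **`solv_iff`** —
  correctness on rows of length `n + 1`;
* the same as a loop (`stepS`, `progS`, `progS_eq_solv`) and **`progSCode : CodeFP rowsE bitE progS`**
  — polynomial time on the codes of row lists, from the typed combinators of `CodeFP.lean` and the
  code-level pieces of `GF2KernelProgram.lean` (`pivotPairCode`, `mapElimCode`).

Design note: solvability could also be read off ranks (`GaussRank.lrank`, `GaussRankFP.lean`:
`rank A = rank [A | b]`), which would need the Rouché–Capelli criterion for lists of rows; the direct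
elimination below is shorter, needs no linear algebra beyond `dotB`, and mirrors `GF2Kernel.hasKer`.

## References

* J. von zur Gathen, J. Gerhard, *Modern Computer Algebra*, 3rd ed., CUP 2013, §12.1 (Gaussian
  elimination over finite fields in polynomial time) [GathenGerhard2013]. Schoolbook; proved here.
* S. Arora, B. Barak, *Computational Complexity: A Modern Approach*, CUP 2009, §1.3 (polynomial
  time is closed under composition and bounded loops) [AroraBarak2009].
-/

namespace Literature.Computability.Complexity

namespace GF2Solve

open GF2Kernel

/-! ### The program and its specification -/

/-- **The solvability test** for augmented rows with `n` coefficient columns (right-hand side last):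
`n` rounds of "eliminate the first column by the first row with a leading `1`, or drop the column",
then check that all right-hand sides vanish. [cite: GathenGerhard2013, §12.1] -/
def solv : ℕ → List (List Bool) → Bool
  | 0, rows => rows.all fun r => !(r.headD false)
  | n + 1, rows => solv n (rows.map (elimRow ((pivot rows).getD [])))

/-- **The specification**: some `x ∈ GF(2)^n` with `a_r · x = b_r` for every augmented row
`r = a_r ++ [b_r]`, i.e. `r · (x ++ [1]) = 0`. [folklore] -/
def Solvable (n : ℕ) (rows : List (List Bool)) : Prop :=
  ∃ x : List Bool, x.length = n ∧ ∀ r ∈ rows, dotB r (x ++ [true]) = false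

/-- On a row without a leading `1` the column step just drops the first entry. [folklore] -/
theorem elimRow_of_headD (p : List Bool) {r : List Bool} (h : r.headD false = false) :
    elimRow p r = r.tail := by
  rw [elimRow, h]
  rfl

/-- The empty system is solvable according to the test. [folklore] -/
theorem solv_nil : ∀ n : ℕ, solv n [] = true
  | 0 => rfl
  | n + 1 => by rw [solv, List.map_nil]; exact solv_nil n

/-- A row of positive length is a cons. [folklore] -/
theorem exists_cons_of_length {r : List Bool} {n : ℕ} (h : r.length = n + 1) : ∃ r₀ r', r = r₀ :: r' := by
  rcases r with _ | ⟨r₀, r'⟩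
  · simp at h
  · exact ⟨r₀, r', rfl⟩

/-- **Correctness of the solvability test** on augmented rows of length `n + 1`.
[cite: GathenGerhard2013, §12.1] -/
theorem solv_iff : ∀ (n : ℕ) (rows : List (List Bool)), (∀ r ∈ rows, r.length = n + 1) →
    (solv n rows = true ↔ Solvable n rows)
  | 0, rows, hlen => by
    simp only [solv, List.all_eq_true, Bool.not_eq_true', Solvable, List.length_eq_zero_iff,
      exists_eq_left, List.nil_append]
    refine forall₂_congr fun r hr => ?_
    obtain ⟨r₀, r', rfl⟩ := exists_cons_of_length (hlen r hr)
    have hr' : r' = [] := by have := hlen _ hr; simpa using this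
    subst hr'
    cases r₀ <;> simp
  | n + 1, rows, hlen => by
    rw [solv, solv_iff n _ (fun r' hr' => by
      obtain ⟨r, hr, rfl⟩ := List.mem_map.1 hr'
      cases hpiv : pivot rows with
      | none =>
        have h0 : r.headD false = false := by
          have := List.find?_eq_none.1 hpiv r hr; simpa using this
        rw [Option.getD_none, elimRow_of_headD [] h0, List.length_tail, hlen r hr]; rfl
      | some p => exact length_elimRow (hlen p (List.mem_of_find?_eq_some hpiv)) (hlen r hr))]
    cases hpiv : pivot rows with
    | none =>
      -- no row has a leading `1`: the first unknown is free
      rw [Option.getD_none]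
      have h0 : ∀ r ∈ rows, r.headD false = false := fun r hr => by
        have := List.find?_eq_none.1 hpiv r hr; simpa using this
      constructor
      · rintro ⟨x', hx', hsol⟩
        refine ⟨false :: x', by simp [hx'], fun r hr => ?_⟩
        obtain ⟨r₀, r', rfl⟩ := exists_cons_of_length (hlen r hr)
        have := h0 _ hr; simp only [List.headD_cons] at this; subst this
        have hk := hsol (elimRow [] (false :: r')) (List.mem_map.2 ⟨_, hr, rfl⟩)
        rw [elimRow_of_headD [] rfl, List.tail_cons] at hk
        simpa using hk
      · rintro ⟨x, hx, hsol⟩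
        obtain ⟨x₀, x', rfl⟩ := exists_cons_of_length hx
        refine ⟨x', by simpa using hx, fun r' hr' => ?_⟩
        obtain ⟨r, hr, rfl⟩ := List.mem_map.1 hr'
        obtain ⟨r₀, r'', rfl⟩ := exists_cons_of_length (hlen r hr)
        have := h0 _ hr; simp only [List.headD_cons] at this; subst this
        rw [elimRow_of_headD [] rfl, List.tail_cons]
        have hk := hsol _ hr
        simpa using hk
    | some p =>
      rw [Option.getD_some]
      have hp : p ∈ rows := List.mem_of_find?_eq_some hpiv
      have hp0 : p.headD false = true := by have := List.find?_some hpiv; simpa using this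
      have hpl : p.length = n + 2 := hlen p hp
      obtain ⟨p₀, p', rfl⟩ := exists_cons_of_length hpl
      simp only [List.headD_cons] at hp0
      subst hp0
      constructor
      · -- from a solution of the eliminated rows to one of the rows
        rintro ⟨x', hx', hsol⟩
        set x₀ := dotB p' (x' ++ [true]) with hx₀
        refine ⟨x₀ :: x', by simp [hx'], fun r hr => ?_⟩
        obtain ⟨r₀, r', rfl⟩ := exists_cons_of_length (hlen r hr)
        have hrl := hlen _ hr
        have hk := hsol (elimRow (true :: p') (r₀ :: r')) (List.mem_map.2 ⟨_, hr, rfl⟩)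
        unfold elimRow at hk
        cases r₀ with
        | false => simpa using hk
        | true =>
          simp only [List.headD_cons, if_true, List.zipWith_cons_cons, List.tail_cons] at hk
          rw [dotB_zipWith_xor _ _ _ (by simp at hrl hpl; omega)] at hk
          rw [List.cons_append, dotB_cons_cons, Bool.true_and, hx₀]
          revert hk; cases dotB r' (x' ++ [true]) <;> cases dotB p' (x' ++ [true]) <;> simp
      · -- from a solution of the rows to one of the eliminated rows
        rintro ⟨x, hx, hsol⟩
        obtain ⟨x₀, x', rfl⟩ := exists_cons_of_length hx
        have hpv : dotB (true :: p') (x₀ :: (x' ++ [true])) = false := hsol _ hp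
        refine ⟨x', by simpa using hx, fun r' hr' => ?_⟩
        obtain ⟨r, hr, rfl⟩ := List.mem_map.1 hr'
        have hrl := hlen r hr
        obtain ⟨r₀, r'', rfl⟩ := exists_cons_of_length hrl
        have hrv : dotB (r₀ :: r'') (x₀ :: (x' ++ [true])) = false := hsol _ hr
        unfold elimRow
        cases r₀ with
        | false => simpa using hrv
        | true =>
          simp only [List.headD_cons, if_true, List.zipWith_cons_cons, List.tail_cons]
          rw [dotB_zipWith_xor _ _ _ (by simp at hrl hpl; omega)]
          rw [dotB_cons_cons, Bool.true_and] at hrv hpv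
          revert hrv hpv
          cases dotB r'' (x' ++ [true]) <;> cases dotB p' (x' ++ [true]) <;> cases x₀ <;> simp

/-! ### The program as a loop, and its polynomial-time realisation on codes -/

section Program

/-- **One round**: eliminate the first column (the pivot search returns `[]` when no row leads with
`1`, and then the column is just dropped). [cite: GathenGerhard2013, §12.1] -/
def stepS (rows : List (List Bool)) : List (List Bool) := rows.map (elimRow (pivotPair rows).2)

/-- The final test: all right-hand sides vanish. [folklore] -/
def finalS (rows : List (List Bool)) : Bool := rows.all fun r => !(r.headD false)

/-- `stepS` is the round of `solv`. [folklore] -/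
theorem stepS_eq (rows : List (List Bool)) : stepS rows = rows.map (elimRow ((pivot rows).getD [])) := by
  rw [stepS, pivotPair_eq]
  cases pivot rows <;> rfl

/-- **`k` rounds followed by the final test compute `solv k`.** [folklore] -/
theorem finalS_iterate_stepS : ∀ (k : ℕ) (rows : List (List Bool)), finalS (stepS^[k] rows) = solv k rows
  | 0, _ => rfl
  | k + 1, rows => by
    rw [Function.iterate_succ_apply, solv, stepS_eq]
    exact finalS_iterate_stepS k _

/-- **The program**: as many rounds as the first row has coefficient columns (its length minus one),
then the final test. [cite: GathenGerhard2013, §12.1] -/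
def progS (rows : List (List Bool)) : Bool :=
  finalS ((rows.headD []).tail.foldl (fun st _ => stepS st) rows)

/-- **The program computes `solv n`** on row lists of common length `n + 1`. [folklore] -/
theorem progS_eq_solv {n : ℕ} {rows : List (List Bool)} (hlen : ∀ r ∈ rows, r.length = n + 1) :
    progS rows = solv n rows := by
  rcases rows with _ | ⟨r₀, rows'⟩
  · -- the empty system
    show true = solv n []
    rw [solv_nil]
  · rw [progS, List.headD_cons, foldl_const_eq_iterate, finalS_iterate_stepS, List.length_tail,
      hlen r₀ (by simp)]
    rfl

/-- **The program decides solvability** on row lists of common length `n + 1`.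
[cite: GathenGerhard2013, §12.1] -/
theorem progS_eq_true_iff {n : ℕ} {rows : List (List Bool)} (hlen : ∀ r ∈ rows, r.length = n + 1) :
    progS rows = true ↔ Solvable n rows := by
  rw [progS_eq_solv hlen]
  exact solv_iff n rows hlen

/-! ### Realisation on codes -/

open CodeFP Polynomial

/-- **One round on codes.** [folklore] -/
theorem stepSCode : CodeFP rowsE rowsE stepS :=
  (mapElimCode.comp (pivotPairCode.snd'.pair (CodeFP.id rowsE))).congr fun _ => rfl

/-- **The final test on codes.** [folklore] -/
theorem finalSCode : CodeFP rowsE bitE finalS :=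
  ((all (headDCode rowsE).not).comp ((CodeFP.id rowsE).pair (CodeFP.id rowsE))).congr fun _ => rfl

/-- The rows along the loop do not lengthen. [folklore] -/
theorem length_rowsE_iterate_stepS_le (rows : List (List Bool)) :
    ∀ (k : ℕ) (st : List (List Bool)), (rowsE st).length ≤ (rowsE rows).length →
      (rowsE (stepS^[k] st)).length ≤ (rowsE rows).length
  | 0, _, h => h
  | k + 1, st, h => by
    rw [Function.iterate_succ_apply]
    apply length_rowsE_iterate_stepS_le rows k
    exact (length_rawE_map_le rowE (fun r => by
      rw [length_rowE, length_rowE]; exact Nat.mul_le_mul_left 4 (length_elimRow_le _ r)) _).trans h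

/-- **The program on codes**: `progS` is computed on the code of the rows by a polynomial-time string
function. [cite: AroraBarak2009, §1.3 (bounded loops)] -/
theorem progSCode : CodeFP rowsE bitE progS := by
  have hstep : CodeFP (pairE rowsE (pairE bitE rowsE)) rowsE (fun t => stepS t.2.2) :=
    stepSCode.comp (snd _ _).snd'
  have hfold := foldl (step := fun (_ : List (List Bool)) (_ : Bool) (st : List (List Bool)) => stepS st)
    (init := fun rows => rows) hstep (CodeFP.id rowsE) (X + 1) (fun rows l₁ _ => by
      rw [foldl_const_eq_iterate, pairE_apply, length_boolPair, eval_add, eval_X, eval_one]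
      dsimp only
      have := length_rowsE_iterate_stepS_le rows l₁.length rows le_rfl
      omega)
  have htail : CodeFP rowsE rowE (fun rows => (rows.headD []).tail) :=
    (rawTail bitE).comp (rawHeadD rowE (d := []) rfl)
  have hrun : CodeFP rowsE rowsE (fun rows => (rows.headD []).tail.foldl (fun st _ => stepS st) rows) :=
    (hfold.comp ((CodeFP.id rowsE).pair htail)).congr fun _ => rfl
  exact (finalSCode.comp hrun).congr fun rows => rfl

end Program

end GF2Solve

end Literature.Computability.Complexity
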